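import Summits.HodgeConjecture.HodgeConjecture.Theorems.F0P6aSiegelCarrierReciprocity
import Literature.AlgebraicGeometry.ShimuraVarieties.UnitaryCurveSpecialPairReciprocity
import Literature.AlgebraicGeometry.ShimuraVarieties.UnitaryCurveSpecialPairOfAuxComplexStructure
import HarnessLib

/-!
# `f_recip` of the E-line chart `AuxChartGS` from E3R (unitary side, ★ `exists_sliceField_siegelRecipDatum` + ★ `isSpecial_auxComplexStructureV_curve`)
# and E3R-S (Siegel side, ★ `smul_q_mk_eq_q_mk_cmRecip_of_forall_mem_apply_eq`) — the GLUE, by name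

Summit `HodgeConjecture`, sub-problem `HodgeConjecture`, crux `stmt-HodgeConjecture-24832` (HLiu418), sub-line P6a, door (E) of `stub_RGD`:
E-line `Cruxes/HLiu418/Lines/F0_P6a_PELWitnessE.lean` ED. 1, field `AuxChartGS.f_recip` (:164–:172).  Cell `hodgecm-mathlib` (D-0151); HONEST LABEL:
HC_CM is proved only modulo the 2 remaining named inputs (hLiu418 24832, h413 24833) until rung 0 closes; this file is a `--supports 24832` helper and
changes no count.  THEOREMS ONLY (one theorem); imports ★ Theorems ∕ ★ Literature only.

WHAT IT PROVES.  For the data GEN holds in the `stub_E123` closure — the Siegel fine moduli scheme `𝓜` with its (U) pieces `(Sc, ιc, unif)`, the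
principal representatives `(u, rep)` and the point bijection `pts` of ★ E3 A4 `UnitaryCurve.exists_moduliPointMapGS` (clauses `hu huc hmult hrep1`,
`hval`), the (U3-D3) clause `hD3` of ★ `siegelModuli_complexUniformisation_holds`, the curve datum `(F, ι₁, J⋆, Φ ∋ ι₁)`, E1's frame
`Fr : SymplecticFrameV F id J⋆ ξ g δ`, E2's complex structure `J = auxComplexStructureV Fr ι₁ Φ` with `hJC : J v ∈ S^±` on the negative cone (★ A3),
and ANY point map `f : Sh_K(U(J⋆))(ℂ) → 𝓜.M(ℂ)_ℚ` reading `[v, aK] ↦ (bce)⁻¹ pts⁻¹ [J v, ũ_V(a,1) K_δ(N)]` (`hf`, = A4's `f_mk`∕`pts` clause) — there is a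
number field `E₀ ⊆ ℂ` containing `ι₁(F)` such that over every slice field `Fᵢ` whose complex embedding `τE` extends `ι₁` and COVERS `E₀`
(`E₀ ⊆ τE(Fᵢ)`), the field `f_recip` holds VERBATIM: `σ • f [ι₁w, a] = f [ι₁w, d·a]` for `σ ∈ Aut(ℂ∕Fᵢ)`, `s` an `F`-idèle Artin correspondent of
`σ`, `w` special, `d = r_w(s)`.  Proof = ★ E3R-U head (the datum `(E, c, Φ′, sE, r, d♯)` + two class identities) ∘ ★ E3R-S head at
`(c, J(ι₁w), Φ′, E, σ|_ℚ, sE, r, ũ_V(a,1))` ∘ `hf`, with the special-pair clause supplied by ★ `isSpecial_auxComplexStructureV_curve`.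
[cite: Milne2005ShimuraVarieties, Def. 12.8 (62) p. 114, Prop. 14.12 p. 125] [cite: Deligne1971TravauxShimura, 5.11 p. 158, Thm. 4.21 p. 152]
[cite: RapoportSmithlingZhang2020Diagonal, Remark 3.1 p. 9, (3.3), (3.10)]
-/

set_option autoImplicit false

noncomputable section

-- the mandated namespace has the single-problem summit's repeated segment (`HodgeConjecture.HodgeConjecture`)
set_option linter.dupNamespace false

namespace Summit.HodgeConjecture.HodgeConjecture.Theorems.F0P6aSpecialPairRecipOfChart

open CategoryTheory AlgebraicGeometry Matrix NumberField IsDedekindDomain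
open Literature.AlgebraicGeometry.ModuliOfAbelianVarieties
open Literature.AlgebraicGeometry.ModuliOfAbelianVarieties.SiegelModuli (jOfSiegel jOfSiegel_mem_C0)
open Literature.AlgebraicGeometry.Motives (SchemeOver ComplexPoints AlgPoints specOver CMType)
open Literature.AlgebraicGeometry.AbelianSchemes (PolarizedAbelianSchemeWithLevel)
open Literature.NumberTheory.Automorphic Literature.NumberTheory.Automorphic.UnitaryGroup
open Literature.AlgebraicGeometry.ShimuraVarieties
open Literature.AlgebraicGeometry.ShimuraVarieties.UnitaryCanonicalModel (IsArtinCorrespondent recipFactor IsDiagTwistGS ShimuraSetGS)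
open Literature.AlgebraicGeometry.ShimuraVarieties.UnitaryCurve.AuxV
open Summit.HodgeConjecture.HodgeConjecture.Theorems.F0P6aSiegelCarrierReciprocity (smul_q_mk_eq_q_mk_cmRecip_of_forall_mem_apply_eq)

/-- **`f_recip` OF THE E-LINE CHART, BY NAME** (door (E) of `stub_RGD`, E-line ED. 1 `AuxChartGS.f_recip` :164–:172): for the Siegel data of the
chart (★ E3 A4 clauses + (U3-D3)), the curve datum, E1's frame, E2's `J = auxComplexStructureV`, and any point map `f` with `pts (f [v, aK]) =
[J v, ũ_V(a,1)]` read in the `ℚ`-structure points, there is a number field `E₀ ∋ ι₁(F)` inside `ℂ` such that for EVERY slice field `Fᵢ` with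
`τE ∘ (F → Fᵢ) = ι₁` and `E₀ ⊆ τE(Fᵢ)`:  `∀ σ ∈ Aut(ℂ∕Fᵢ), ∀ s` (Artin correspondent of `σ` over `F`), `∀ w` special, `∀ d = r_w(s)`, `∀ a`,
`σ • f [ι₁w, aK] = f [ι₁w, d·aK]` — GEN takes `Fi₀ ⊇ E₀` in `stub_E123`.  ★ E3R-U (`exists_sliceField_siegelRecipDatum`, `isSpecial_auxComplexStructureV_curve`)
∘ ★ E3R-S (`smul_q_mk_eq_q_mk_cmRecip_of_forall_mem_apply_eq`). [cite: Milne2005ShimuraVarieties, Def. 12.8 (62) p. 114 and Prop. 14.12 p. 125]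
[cite: Deligne1971TravauxShimura, 5.11 p. 158 and Thm. 4.21 p. 152] [cite: RapoportSmithlingZhang2020Diagonal, Remark 3.1 p. 9 and (3.10)] -/
theorem exists_sliceField_f_recip {g N : ℕ} {δ : Fin g → ℕ} (hg : 0 < g) (hδ : IsPolarizationType δ) (hN : 3 ≤ N)
    (𝓜 : SiegelFineModuliScheme g N δ)
    {Sc : (ZMod N)ˣ → SchemeOver ℂ} (ιc : ∀ c, Sc c ⟶ (Literature.AlgebraicGeometry.Motives.baseChange ℚ ℂ).obj 𝓜.M)
    (unif : ∀ _c : (ZMod N)ˣ, Matrix (Fin g) (Fin g) ℂ → ComplexPoints (Sc _c))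
    {u : (ZMod N)ˣ → finAdeleQˣ} {rep : (ZMod N)ˣ → ↥(gspFinAdelic δ)}
    (hu : ∀ c w, Valued.v ((u c : finAdeleQ) w) = 1)
    (huc : ∀ c, (u c : finAdeleQ) - ((c : ZMod N).val : ℕ) ∈ levelIdeal N)
    (hmult : ∀ c, IsMultiplier (typeFormOver δ finAdeleQ) (rep c : GL (Fin g ⊕ Fin g) finAdeleQ) (u c))
    (hD3 : haveI : IsLocallyNoetherian (specOver ℚ ℂ).left := inferInstanceAs (IsLocallyNoetherian (Spec (CommRingCat.of ℂ)))
      ∀ (c : (ZMod N)ˣ) (Z : Matrix (Fin g) (Fin g) ℂ) (hZ : Z ∈ siegelUpperHalfSpace g)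
        (P' : PolarizedAbelianSchemeWithLevel g N δ (specOver ℚ ℂ).left), IsAdmissibleAt hδ (rep c) Z hZ P' →
          AlgPoints.map (ιc c) (unif c Z) =
            AlgPoints.baseChangeEquiv (algebraMap ℚ ℂ) 𝓜.M (𝓜.classifyingMap (specOver ℚ ℂ) P'))
    (pts : ComplexPoints ((Literature.AlgebraicGeometry.Motives.baseChange ℚ ℂ).obj 𝓜.M) ≃
      SiegelShimuraSet δ (principalLevelSubgroup δ N))
    (hval : ∀ (c : (ZMod N)ˣ) (W : Matrix (Fin g) (Fin g) ℂ) (hW : W ∈ siegelUpperHalfSpace g),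
      pts (AlgPoints.map (ιc c) (unif c W)) =
        SiegelShimuraSet.mk δ (principalLevelSubgroup δ N)
          ⟨jOfSiegel δ W, C0_subset_C0pm δ (jOfSiegel_mem_C0 hδ.1 hW)⟩ (rep c))
    -- the curve datum, the frame, E2's complex structure
    {F : Type} [Field F] [NumberField F] [IsCMField F] (ι₁ : F →+* ℂ) (Jstar : Matrix (Fin 2) (Fin 2) F)
    (hJ : (Jstar.map (IsCMField.complexConj F))ᵀ = Jstar) (Φ : CMType F) (hΦ : ι₁ ∈ Φ.1) {ξ : F}
    (Fr : SymplecticFrameV F (RingHom.id F) Jstar ξ g δ)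
    (hJC : ∀ v : Fin 2 → ℂ, v ∈ negCone (Jstar.map ι₁) → auxComplexStructureV Fr ι₁ Φ v ∈ C0pm δ)
    -- the point map, at any level `K`
    (K : Subgroup ↥(finAdelic (↥(maximalRealSubfield F)) F (IsCMField.complexConj F) 2 Jstar))
    (f : ShimuraSetGS F Jstar ι₁ K → ComplexPoints 𝓜.M)
    (hf : ∀ (v : Fin 2 → ℂ) (hv : v ∈ negCone (Jstar.map ι₁)) (a : ↥(finAdelic (↥(maximalRealSubfield F)) F (IsCMField.complexConj F) 2 Jstar)),
      pts (AlgPoints.baseChangeEquiv (algebraMap ℚ ℂ) 𝓜.M (f (ShimuraSetGS.mk F Jstar ι₁ K v hv a))) =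
        SiegelShimuraSet.mk δ (principalLevelSubgroup δ N) ⟨auxComplexStructureV Fr ι₁ Φ v, hJC v hv⟩ (auxToGspFinV Fr (a, 1))) :
    ∃ E₀ : IntermediateField ℚ ℂ, FiniteDimensional ℚ ↥E₀ ∧ (∀ x : F, ι₁ x ∈ E₀) ∧
      ∀ (Fi : Type) [Field Fi] [NumberField Fi] [Algebra F Fi] (τE : Fi →+* ℂ),
        (∀ x : ℂ, x ∈ E₀ → ∃ y : Fi, τE y = x) →
        letI : Algebra Fi ℂ := τE.toAlgebra
        ∀ (σ : ℂ ≃ₐ[Fi] ℂ) (s : (FiniteAdeleRing (𝓞 F) F)ˣ), IsArtinCorrespondent F ι₁ s σ.toRingEquiv →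
          ∀ (w : Fin 2 → F) (hw : (fun i => ι₁ (w i)) ∈ negCone (Jstar.map ι₁))
            (d : ↥(finAdelic (↥(maximalRealSubfield F)) F (IsCMField.complexConj F) 2 Jstar)),
            IsDiagTwistGS F Jstar w (recipFactor F s) d →
            ∀ a : ↥(finAdelic (↥(maximalRealSubfield F)) F (IsCMField.complexConj F) 2 Jstar),
              (σ.restrictScalars ℚ) • f (ShimuraSetGS.mk F Jstar ι₁ K (fun i => ι₁ (w i)) hw a) =
                f (ShimuraSetGS.mk F Jstar ι₁ K (fun i => ι₁ (w i)) hw (d * a)) := by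
  classical
  have hN0 : N ≠ 0 := by omega
  -- E3R-U head, with the special-pair clause of E2's `J`
  obtain ⟨E₀, hfd, hι₁E₀, hrecip⟩ := exists_sliceField_siegelRecipDatum ι₁ Jstar hJ Φ hΦ hN0 Fr (auxComplexStructureV Fr ι₁ Φ) hJC
    (fun w hw b hb1 hperp c hc Φ' h0 h1 => isSpecial_auxComplexStructureV_curve ι₁ Jstar hJ Φ Fr hJC w hw b hb1 hperp c hc Φ' h0 h1)
  refine ⟨E₀, hfd, hι₁E₀, fun Fi _ _ _ τE hcov => ?_⟩
  letI : Algebra Fi ℂ := τE.toAlgebra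
  intro σ s hs w hw d hd a
  -- `σ|_ℚ` fixes `E₀ ⊆ τE(Fᵢ)`
  have hσ₀ : ∀ x : ℂ, x ∈ E₀ → (σ.restrictScalars ℚ) x = x := by
    intro x hx
    obtain ⟨y, rfl⟩ := hcov x hx
    exact σ.commutes y
  obtain ⟨E, hEnf, c, Φ', sE, r, d', hsp, hE, hEE₀, hsE, hr, hsiegel, hGS⟩ :=
    hrecip (σ.restrictScalars ℚ) hσ₀ s hs w hw d hd a
  haveI : NumberField ↥E := hEnf
  -- E3R-S head at the special pair `(c, J(ι₁ w), Φ′)`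
  have hS := smul_q_mk_eq_q_mk_cmRecip_of_forall_mem_apply_eq hg hδ hN 𝓜 ιc unif hu huc hmult hD3 pts hval (Fin 2) (fun _ => F) c
    ⟨auxComplexStructureV Fr ι₁ Φ (fun i => ι₁ (w i)), hJC _ hw⟩ Φ' hsp E hE (σ.restrictScalars ℚ)
    (fun x hx => hσ₀ x (hEE₀ hx)) sE hsE r hr (auxToGspFinV Fr (a, 1))
  -- read both sides through `f`
  have hread : ∀ a' : ↥(finAdelic (↥(maximalRealSubfield F)) F (IsCMField.complexConj F) 2 Jstar),
      f (ShimuraSetGS.mk F Jstar ι₁ K (fun i => ι₁ (w i)) hw a') =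
        (AlgPoints.baseChangeEquiv (algebraMap ℚ ℂ) 𝓜.M).symm (pts.symm (SiegelShimuraSet.mk δ (principalLevelSubgroup δ N)
          ⟨auxComplexStructureV Fr ι₁ Φ (fun i => ι₁ (w i)), hJC _ hw⟩ (auxToGspFinV Fr (a', 1)))) := by
    intro a'
    have h1 : (AlgPoints.baseChangeEquiv (algebraMap ℚ ℂ) 𝓜.M) (f (ShimuraSetGS.mk F Jstar ι₁ K (fun i => ι₁ (w i)) hw a')) =
        pts.symm (SiegelShimuraSet.mk δ (principalLevelSubgroup δ N)
          ⟨auxComplexStructureV Fr ι₁ Φ (fun i => ι₁ (w i)), hJC _ hw⟩ (auxToGspFinV Fr (a', 1))) :=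
      (Equiv.eq_symm_apply pts).2 (hf _ hw a')
    exact (Equiv.eq_symm_apply (AlgPoints.baseChangeEquiv (algebraMap ℚ ℂ) 𝓜.M)).2 h1
  have hfa := hread a
  have hfd := hread (d' * a)
  rw [hGS K, hfa, hS, hsiegel, ← hfd]

end Summit.HodgeConjecture.HodgeConjecture.Theorems.F0P6aSpecialPairRecipOfChart

end
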